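import Literature.Analysis.FluidPDE.RemainderTestedEnergyIdentity
import HarnessLib

/-!
# The global energy inequality of the remainder `w = u − E`

Analysis/FluidPDE support file (theorems only) on the discharge path of
`Literature.Analysis.FluidPDE.AlbrittonBarker2019_liouville_weakL3_backward` (Barker–Seregin–Šverák,
arXiv:1603.03211, Lemma 3.4: the global energy method for `w = u − E`). The tested two-time
inequality `remainder_tested_energy_inequality` is applied with the spatial cut-off
`ψ_R = cutoff R` (`= 1` on `B_R`, `|∇ψ_R| ≤ C/R`, `|Δψ_R| ≤ C/R²`) and `R → ∞`: when the slices
`w(t)` are in `L²` (locally uniformly in `t ∈ (0, S)`), the pressure is in `L²` of the slab, `∇E`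
is bounded by `D(t)` and `|∇E||E| ∈ L²` with `‖|∇E||E|‖₂ ≤ M(t)`, the cut-off terms vanish in the
limit and the coupling `−2∫ψ_R⟪(u·∇)E, w⟫` is bounded slice-wise by
`2(D‖w‖₂² + M‖w‖₂)` (`u = w + E`, Cauchy–Schwarz), giving
`‖w(t₂)‖₂² ≤ ‖w(t₁)‖₂² + 2∫_{t₁}^{t₂} (D(t)‖w(t)‖₂² + M(t)‖w(t)‖₂) dt`, `0 < t₁ ≤ t₂ < S`
(`remainder_energy_inequality`).

## References

* T. Barker, G. Seregin, V. Šverák, arXiv:1603.03211, Lemma 3.4 (proof). [`BarkerSeregin2016`]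
-/

noncomputable section

open MeasureTheory Set Function Filter Metric TopologicalSpace InnerProductSpace
open _root_.Topology
open scoped NNReal ENNReal Laplacian RealInnerProductSpace ContDiff

namespace Literature.Analysis.FluidPDE

open UnboundedOperators FunctionSpaces

variable {S : ℝ} {u E' : ℝ → EuclideanSpace ℝ (Fin 3) → EuclideanSpace ℝ (Fin 3)}
  {p : ℝ → EuclideanSpace ℝ (Fin 3) → ℝ}

/-! ### The coupling term on a slice -/

/-- **Slice bound of the coupling** `⟪(u·∇)E, w⟫ = ⟪DE(w), w⟫ + ⟪DE(E), w⟫` (`u = w + E`):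
`∫ |⟪DE(u), w⟫| ≤ D ‖w‖₂² + M ‖w‖₂` when `|DE| ≤ D` and `‖|DE||E|‖₂ ≤ M` (Cauchy–Schwarz).
[cite: BarkerSeregin2016, Lemma 3.4 (proof)] -/
theorem integral_abs_coupling_le {t : ℝ} (huc : Continuous (u t))
    (hwc : Continuous fun x => u t x - E' t x) (hDEc : Continuous fun x => fderiv ℝ (E' t) x)
    (hw2 : MemLp (fun x => u t x - E' t x) 2 volume) {Dt Mt : ℝ}
    (hD : ∀ x, ‖fderiv ℝ (E' t) x‖ ≤ Dt)
    (hME : MemLp (fun x => ‖fderiv ℝ (E' t) x‖ * ‖E' t x‖) 2 volume)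
    (hM : ∫ x, (‖fderiv ℝ (E' t) x‖ * ‖E' t x‖) ^ 2 ≤ Mt ^ 2) (hM0 : 0 ≤ Mt) :
    Integrable (fun x => ⟪fderiv ℝ (E' t) x (u t x), u t x - E' t x⟫) volume ∧
    ∫ x, |⟪fderiv ℝ (E' t) x (u t x), u t x - E' t x⟫| ≤
      Dt * (∫ x, ‖u t x - E' t x‖ ^ 2) + Mt * Real.sqrt (∫ x, ‖u t x - E' t x‖ ^ 2) := by
  haveI : ENNReal.HolderTriple 2 2 1 := ENNReal.HolderConjugate.instTwoTwo
  have hD0 : 0 ≤ Dt := (norm_nonneg _).trans (hD 0)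
  have hy : Integrable (fun x => ‖u t x - E' t x‖ ^ 2) volume :=
    (memLp_two_iff_integrable_sq_norm hw2.1).1 hw2
  have hf2 : Integrable (fun x => (‖fderiv ℝ (E' t) x‖ * ‖E' t x‖) * ‖u t x - E' t x‖) volume := by
    have h := hME.integrable_mul hw2.norm
    exact h
  have hpt : ∀ x, |⟪fderiv ℝ (E' t) x (u t x), u t x - E' t x⟫| ≤
      Dt * ‖u t x - E' t x‖ ^ 2 + (‖fderiv ℝ (E' t) x‖ * ‖E' t x‖) * ‖u t x - E' t x‖ := by
    intro x
    have hu : u t x = (u t x - E' t x) + E' t x := by abel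
    calc |⟪fderiv ℝ (E' t) x (u t x), u t x - E' t x⟫|
        ≤ ‖fderiv ℝ (E' t) x (u t x)‖ * ‖u t x - E' t x‖ := abs_real_inner_le_norm _ _
      _ ≤ (‖fderiv ℝ (E' t) x‖ * (‖u t x - E' t x‖ + ‖E' t x‖)) * ‖u t x - E' t x‖ := by
          gcongr
          refine (ContinuousLinearMap.le_opNorm _ _).trans ?_
          gcongr
          conv_lhs => rw [hu]
          exact norm_add_le _ _
      _ = ‖fderiv ℝ (E' t) x‖ * ‖u t x - E' t x‖ ^ 2 +
            (‖fderiv ℝ (E' t) x‖ * ‖E' t x‖) * ‖u t x - E' t x‖ := by ring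
      _ ≤ Dt * ‖u t x - E' t x‖ ^ 2 + (‖fderiv ℝ (E' t) x‖ * ‖E' t x‖) * ‖u t x - E' t x‖ := by
          gcongr
          exact hD x
  have hmeas : AEStronglyMeasurable (fun x => ⟪fderiv ℝ (E' t) x (u t x), u t x - E' t x⟫) volume :=
    ((hDEc.clm_apply huc).inner hwc).aestronglyMeasurable
  have hint : Integrable (fun x => ⟪fderiv ℝ (E' t) x (u t x), u t x - E' t x⟫) volume :=
    ((hy.const_mul Dt).add hf2).mono' hmeas (Eventually.of_forall fun x => by
      rw [Real.norm_eq_abs]; exact hpt x)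
  refine ⟨hint, ?_⟩
  have hCS : ∫ x, (‖fderiv ℝ (E' t) x‖ * ‖E' t x‖) * ‖u t x - E' t x‖ ≤
      Real.sqrt (∫ x, (‖fderiv ℝ (E' t) x‖ * ‖E' t x‖) ^ 2) * Real.sqrt (∫ x, ‖u t x - E' t x‖ ^ 2) :=
    integral_mul_le_sqrt_mul_sqrt (fun x => by positivity) (fun x => norm_nonneg _)
      hME.1 hw2.1.norm ((memLp_two_iff_integrable_sq hME.1).1 hME) hy
  calc ∫ x, |⟪fderiv ℝ (E' t) x (u t x), u t x - E' t x⟫|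
      ≤ ∫ x, (Dt * ‖u t x - E' t x‖ ^ 2 + (‖fderiv ℝ (E' t) x‖ * ‖E' t x‖) * ‖u t x - E' t x‖) :=
        integral_mono hint.abs ((hy.const_mul Dt).add hf2) hpt
    _ = Dt * (∫ x, ‖u t x - E' t x‖ ^ 2) +
          ∫ x, (‖fderiv ℝ (E' t) x‖ * ‖E' t x‖) * ‖u t x - E' t x‖ := by
        rw [integral_add (hy.const_mul Dt) hf2, integral_const_mul]
    _ ≤ Dt * (∫ x, ‖u t x - E' t x‖ ^ 2) + Mt * Real.sqrt (∫ x, ‖u t x - E' t x‖ ^ 2) := by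
        gcongr
        refine hCS.trans ?_
        gcongr
        calc Real.sqrt (∫ x, (‖fderiv ℝ (E' t) x‖ * ‖E' t x‖) ^ 2) ≤ Real.sqrt (Mt ^ 2) :=
              Real.sqrt_le_sqrt hM
          _ = Mt := Real.sqrt_sq hM0

/-! ### `L²` of the strip from slice bounds -/

/-- **Tonelli on the strip**: if `w` is continuous on the open slab and `∫|w(t)|² ≤ B` for
`t ∈ (t₁, t₂] ⊂ (0, S)`, then `|w|²` is integrable on `(t₁, t₂] × ℝ³` with integral
`≤ (t₂ − t₁) B`. [folklore] -/
theorem integrableOn_norm_sq_strip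
    (cw : ContinuousOn (fun z : ℝ × EuclideanSpace ℝ (Fin 3) => u z.1 z.2 - E' z.1 z.2) (Ioo 0 S ×ˢ univ))
    {t₁ t₂ B : ℝ} (ht₁ : 0 < t₁) (h12 : t₁ ≤ t₂) (ht₂ : t₂ < S)
    (hB : ∀ t ∈ Ioc t₁ t₂, MemLp (fun x => u t x - E' t x) 2 volume ∧ ∫ x, ‖u t x - E' t x‖ ^ 2 ≤ B) :
    IntegrableOn (fun z : ℝ × EuclideanSpace ℝ (Fin 3) => ‖u z.1 z.2 - E' z.1 z.2‖ ^ 2)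
        (Ioc t₁ t₂ ×ˢ (univ : Set (EuclideanSpace ℝ (Fin 3)))) volume ∧
      ∫ z in Ioc t₁ t₂ ×ˢ (univ : Set (EuclideanSpace ℝ (Fin 3))), ‖u z.1 z.2 - E' z.1 z.2‖ ^ 2 ≤
        (t₂ - t₁) * B := by
  have hsub : Ioc t₁ t₂ ×ˢ (univ : Set (EuclideanSpace ℝ (Fin 3))) ⊆ Ioo 0 S ×ˢ univ :=
    prod_mono (fun t ht => ⟨ht₁.trans ht.1, ht.2.trans_lt ht₂⟩) Subset.rfl
  have hm : MeasurableSet (Ioc t₁ t₂ ×ˢ (univ : Set (EuclideanSpace ℝ (Fin 3)))) :=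
    measurableSet_Ioc.prod MeasurableSet.univ
  have hmeas : AEStronglyMeasurable (fun z : ℝ × EuclideanSpace ℝ (Fin 3) => ‖u z.1 z.2 - E' z.1 z.2‖ ^ 2)
      (volume.restrict (Ioc t₁ t₂ ×ˢ (univ : Set (EuclideanSpace ℝ (Fin 3))))) :=
    ((cw.mono hsub).norm.pow 2).aestronglyMeasurable hm
  have hμ : (volume : Measure (ℝ × EuclideanSpace ℝ (Fin 3))).restrict
      (Ioc t₁ t₂ ×ˢ (univ : Set (EuclideanSpace ℝ (Fin 3)))) =
      ((volume : Measure ℝ).restrict (Ioc t₁ t₂)).prod (volume : Measure (EuclideanSpace ℝ (Fin 3))) := by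
    rw [Measure.volume_eq_prod, Measure.restrict_prod_eq_prod_univ]
  rcases eq_or_lt_of_le h12 with heq | hlt
  · subst heq
    simp
  -- slice `lintegral`s
  have hsl : ∀ t ∈ Ioc t₁ t₂, ∫⁻ x, ‖‖u t x - E' t x‖ ^ 2‖ₑ = ENNReal.ofReal (∫ x, ‖u t x - E' t x‖ ^ 2) := by
    intro t ht
    obtain ⟨hw2, -⟩ := hB t ht
    have hy : Integrable (fun x => ‖u t x - E' t x‖ ^ 2) volume :=
      (memLp_two_iff_integrable_sq_norm hw2.1).1 hw2
    rw [ofReal_integral_eq_lintegral_ofReal hy (Eventually.of_forall fun x => by positivity)]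
    refine lintegral_congr fun x => ?_
    rw [Real.enorm_eq_ofReal (by positivity)]
  have hmeas' : AEStronglyMeasurable (fun z : ℝ × EuclideanSpace ℝ (Fin 3) => ‖u z.1 z.2 - E' z.1 z.2‖ ^ 2)
      (((volume : Measure ℝ).restrict (Ioc t₁ t₂)).prod (volume : Measure (EuclideanSpace ℝ (Fin 3)))) := by
    rw [← hμ]; exact hmeas
  have hvol : (volume : Measure ℝ) (Ioc t₁ t₂) = ENNReal.ofReal (t₂ - t₁) := Real.volume_Ioc
  have hlin : ∫⁻ z, ‖‖u z.1 z.2 - E' z.1 z.2‖ ^ 2‖ₑ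
      ∂(((volume : Measure ℝ).restrict (Ioc t₁ t₂)).prod (volume : Measure (EuclideanSpace ℝ (Fin 3)))) ≤
      ENNReal.ofReal B * ENNReal.ofReal (t₂ - t₁) := by
    rw [lintegral_prod _ hmeas'.enorm]
    calc ∫⁻ t in Ioc t₁ t₂, ∫⁻ x, ‖‖u (t, x).1 (t, x).2 - E' (t, x).1 (t, x).2‖ ^ 2‖ₑ
        ≤ ∫⁻ _ in Ioc t₁ t₂, ENNReal.ofReal B := by
          refine lintegral_mono_ae ?_
          filter_upwards [ae_restrict_mem measurableSet_Ioc] with t ht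
          rw [show (fun x : EuclideanSpace ℝ (Fin 3) => ‖‖u (t, x).1 (t, x).2 - E' (t, x).1 (t, x).2‖ ^ 2‖ₑ) =
            fun x => ‖‖u t x - E' t x‖ ^ 2‖ₑ from rfl, hsl t ht]
          exact ENNReal.ofReal_le_ofReal (hB t ht).2
      _ = ENNReal.ofReal B * ENNReal.ofReal (t₂ - t₁) := by
          rw [lintegral_const, Measure.restrict_apply_univ, hvol]
  have hint : IntegrableOn (fun z : ℝ × EuclideanSpace ℝ (Fin 3) => ‖u z.1 z.2 - E' z.1 z.2‖ ^ 2)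
      (Ioc t₁ t₂ ×ˢ (univ : Set (EuclideanSpace ℝ (Fin 3)))) volume := by
    refine ⟨hmeas, ?_⟩
    rw [HasFiniteIntegral, hμ]
    exact hlin.trans_lt (ENNReal.mul_lt_top ENNReal.ofReal_lt_top ENNReal.ofReal_lt_top)
  refine ⟨hint, ?_⟩
  have hint' : Integrable (fun z : ℝ × EuclideanSpace ℝ (Fin 3) => ‖u z.1 z.2 - E' z.1 z.2‖ ^ 2)
      (((volume : Measure ℝ).restrict (Ioc t₁ t₂)).prod (volume : Measure (EuclideanSpace ℝ (Fin 3)))) := by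
    have h := hint; rw [IntegrableOn, hμ] at h; exact h
  have hmarg : IntegrableOn (fun t => ∫ x, ‖u t x - E' t x‖ ^ 2) (Ioc t₁ t₂) volume := hint'.integral_prod_left
  calc ∫ z in Ioc t₁ t₂ ×ˢ (univ : Set (EuclideanSpace ℝ (Fin 3))), ‖u z.1 z.2 - E' z.1 z.2‖ ^ 2
      = ∫ t in Ioc t₁ t₂, ∫ x, ‖u t x - E' t x‖ ^ 2 := by
        rw [show (∫ z in Ioc t₁ t₂ ×ˢ (univ : Set (EuclideanSpace ℝ (Fin 3))), ‖u z.1 z.2 - E' z.1 z.2‖ ^ 2) =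
          ∫ z, ‖u z.1 z.2 - E' z.1 z.2‖ ^ 2 ∂(((volume : Measure ℝ).restrict (Ioc t₁ t₂)).prod
            (volume : Measure (EuclideanSpace ℝ (Fin 3)))) by rw [← hμ], integral_prod _ hint']
    _ ≤ ∫ _ in Ioc t₁ t₂, B :=
        setIntegral_mono_on hmarg (integrableOn_const (hs := by rw [hvol]; exact ENNReal.ofReal_ne_top))
          measurableSet_Ioc fun t ht => (hB t ht).2
    _ = (t₂ - t₁) * B := by
        rw [setIntegral_const, smul_eq_mul, Measure.real, hvol, ENNReal.toReal_ofReal (by linarith)]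

/-! ### The cut-off and its limit -/

/-- `‖∇χ_R‖ = ‖Dχ_R‖ ≤ C/R` for the dyadic cut-off. [folklore] -/
theorem norm_gradient_cutoff_le :
    ∃ C : ℝ, 0 ≤ C ∧ ∀ R : ℝ, 0 < R → ∀ x : EuclideanSpace ℝ (Fin 3),
      ‖gradient (cutoff R : EuclideanSpace ℝ (Fin 3) → ℝ) x‖ ≤ C / R := by
  obtain ⟨C, hC0, hC⟩ := exists_norm_fderiv_cutoff_le (E := EuclideanSpace ℝ (Fin 3))
  refine ⟨C, hC0, fun R hR x => ?_⟩
  rw [gradient, LinearIsometryEquiv.norm_map]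
  exact hC R hR x

/-- **`∫ χ_{n+1} |w(t)|² → ∫ |w(t)|²`** for an `L²` slice (dominated convergence; `χ_R = 1` on
`B_R`). [folklore] -/
theorem tendsto_integral_cutoff_mul_norm_sq {w : EuclideanSpace ℝ (Fin 3) → EuclideanSpace ℝ (Fin 3)}
    (hw : MemLp w 2 volume) :
    Tendsto (fun n : ℕ => ∫ x, cutoff ((n : ℝ) + 1) x * ‖w x‖ ^ 2) atTop (𝓝 (∫ x, ‖w x‖ ^ 2)) := by
  have hy : Integrable (fun x => ‖w x‖ ^ 2) volume := (memLp_two_iff_integrable_sq_norm hw.1).1 hw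
  refine tendsto_integral_of_dominated_convergence (fun x => ‖w x‖ ^ 2) (fun n => ?_) hy (fun n => ?_) ?_
  · exact ((contDiff_cutoff (n := 0) ((n : ℝ) + 1)).continuous.aestronglyMeasurable.mul (hw.1.norm.pow 2))
  · refine Eventually.of_forall fun x => ?_
    rw [norm_mul, norm_pow, norm_norm, Real.norm_of_nonneg (cutoff_nonneg _ _)]
    exact mul_le_of_le_one_left (by positivity) (cutoff_le_one _ _)
  · refine Eventually.of_forall fun x => ?_
    refine (tendsto_const_nhds (x := ‖w x‖ ^ 2)).congr' ?_
    refine eventually_atTop.2 ⟨⌈‖x‖⌉₊, fun n hn => ?_⟩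
    have hR : (0 : ℝ) < (n : ℝ) + 1 := by positivity
    have hx : ‖x‖ ≤ (n : ℝ) + 1 := (Nat.le_ceil ‖x‖).trans (by exact_mod_cast Nat.le_succ_of_le hn)
    simp only [cutoff_eq_one hR hx, one_mul]

/-! ### The global two-time energy inequality -/

/-- **Global two-time energy inequality for the remainder `w = u − E`** (Barker–Seregin–Šverák
2016, proof of Lemma 3.4: the energy estimate for `w`). In the setting of
`remainder_tested_energy_inequality`, assume moreover that the slices `w(t)` are in `L²` with
`∫|w(t)|²` bounded on every `(δ, S)`, that `|∇E(t)| ≤ D(t)` and `‖|∇E(t)||E(t)|‖₂ ≤ M(t)` with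
`D`, `M` continuous on `(0, ∞)`. Then `t ↦ ∫|w(t)|²` is measurable on `(0, S)` and for
`0 < t₁ ≤ t₂ < S`:
`∫|w(t₂)|² ≤ ∫|w(t₁)|² + 2 ∫_{t₁}^{t₂} (D(t) ∫|w(t)|² + M(t) (∫|w(t)|²)^{1/2}) dt`
(test with `χ_R`, let `R → ∞`: the cut-off terms are `O(1/R)` by the `L²` bounds on `w` and `p`,
and `|∫χ_R⟪(u·∇)E, w⟫| ≤ D∫|w|² + M‖w‖₂`). [cite: BarkerSeregin2016, Lemma 3.4 (proof)] -/
theorem remainder_energy_inequality (hS : 0 < S)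
    (hcont : ContinuousOn (uncurry u) (Icc 0 S ×ˢ univ)) {K : ℝ}
    (hK : ∀ t ∈ Icc 0 S, ∀ x, ‖u t x‖ ≤ K) (hdiv : ∀ t ∈ Icc 0 S, IsWeaklyDivFree (u t))
    (hmild : ∀ s t : ℝ, 0 ≤ s → s < t → t ≤ S → ∀ x,
      u t x = heatExtension (u s) (t - s) x - oseenDuhamel 1 s u u t x)
    (hEc : ContinuousOn (fun q : ℝ × EuclideanSpace ℝ (Fin 3) => E' q.1 q.2) (Ioi 0 ×ˢ univ))
    (hEDc : ContinuousOn (fun q : ℝ × EuclideanSpace ℝ (Fin 3) => fderiv ℝ (E' q.1) q.2) (Ioi 0 ×ˢ univ))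
    (hEΔc : ContinuousOn (fun q : ℝ × EuclideanSpace ℝ (Fin 3) => (Δ (E' q.1)) q.2) (Ioi 0 ×ˢ univ))
    (hEsm : ∀ t, 0 < t → ContDiff ℝ 2 (E' t)) (hEdiv : ∀ t, 0 < t → VectorCalculus.IsDivFree (E' t))
    (hEt : ∀ t, 0 < t → ∀ x, HasDerivAt (fun s => E' s x) ((Δ (E' t)) x) t)
    (hEB : ∀ δ : ℝ, 0 < δ → ∃ B : ℝ, ∀ t ∈ Ico δ S, ∀ x, ‖E' t x‖ ≤ B ∧ ‖fderiv ℝ (E' t) x‖ ≤ B)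
    (hNS : IsDistributionalNSSolutionOn (slab (EuclideanSpace ℝ (Fin 3)) (Ioo 0 S) isOpen_Ioo) 1 0 u p)
    (hp2 : MemLp (uncurry p) 2 (volume.restrict (Ioo 0 S ×ˢ (univ : Set (EuclideanSpace ℝ (Fin 3))))))
    (hw : ∀ δ : ℝ, 0 < δ → ∃ Bw : ℝ, ∀ t ∈ Ioo δ S,
      MemLp (fun x => u t x - E' t x) 2 volume ∧ ∫ x, ‖u t x - E' t x‖ ^ 2 ≤ Bw)
    {D M : ℝ → ℝ} (hDc : ContinuousOn D (Ioi 0)) (hMc : ContinuousOn M (Ioi 0)) (hM0 : ∀ t, 0 ≤ M t)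
    (hD : ∀ t ∈ Ioo 0 S, ∀ x, ‖fderiv ℝ (E' t) x‖ ≤ D t)
    (hME : ∀ t ∈ Ioo 0 S, MemLp (fun x => ‖fderiv ℝ (E' t) x‖ * ‖E' t x‖) 2 volume ∧
      ∫ x, (‖fderiv ℝ (E' t) x‖ * ‖E' t x‖) ^ 2 ≤ M t ^ 2) :
    AEStronglyMeasurable (fun t => ∫ x, ‖u t x - E' t x‖ ^ 2) (volume.restrict (Ioo 0 S)) ∧
    ∀ ⦃t₁ t₂ : ℝ⦄, 0 < t₁ → t₁ ≤ t₂ → t₂ < S →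
      IntegrableOn (fun t => D t * (∫ x, ‖u t x - E' t x‖ ^ 2) +
        M t * Real.sqrt (∫ x, ‖u t x - E' t x‖ ^ 2)) (Ioc t₁ t₂) volume ∧
      ∫ x, ‖u t₂ x - E' t₂ x‖ ^ 2 ≤ (∫ x, ‖u t₁ x - E' t₁ x‖ ^ 2) +
        2 * ∫ t in Ioc t₁ t₂, (D t * (∫ x, ‖u t x - E' t x‖ ^ 2) +
          M t * Real.sqrt (∫ x, ‖u t x - E' t x‖ ^ 2)) := by
  -- the cut-offs `χₙ = cutoff (n + 1)`
  have hR : ∀ n : ℕ, (0 : ℝ) < (n : ℝ) + 1 := fun n => by positivity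
  have hψsm : ∀ n : ℕ, ContDiff ℝ (⊤ : ℕ∞) (cutoff ((n : ℝ) + 1) : EuclideanSpace ℝ (Fin 3) → ℝ) :=
    fun n => contDiff_cutoff _
  have hψcs : ∀ n : ℕ, HasCompactSupport (cutoff ((n : ℝ) + 1) : EuclideanSpace ℝ (Fin 3) → ℝ) :=
    fun n => hasCompactSupport_cutoff (hR n)
  obtain ⟨Cg, hCg0, hCg⟩ := norm_gradient_cutoff_le
  obtain ⟨CΔ, hCΔ0, hCΔ⟩ := exists_abs_laplacian_cutoff_le (E := EuclideanSpace ℝ (Fin 3))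
  -- continuity on the open slab
  have hQI : Ioo 0 S ×ˢ (univ : Set (EuclideanSpace ℝ (Fin 3))) ⊆ Ioi 0 ×ˢ univ :=
    prod_mono (fun t ht => ht.1) Subset.rfl
  have cu : ContinuousOn (fun z : ℝ × EuclideanSpace ℝ (Fin 3) => u z.1 z.2) (Ioo 0 S ×ˢ univ) :=
    hcont.mono (prod_mono Ioo_subset_Icc_self Subset.rfl)
  have cw : ContinuousOn (fun z : ℝ × EuclideanSpace ℝ (Fin 3) => u z.1 z.2 - E' z.1 z.2) (Ioo 0 S ×ˢ univ) :=
    cu.sub (hEc.mono hQI)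
  have hslice : ∀ t ∈ Ioo 0 S, Continuous (u t) ∧ (Continuous fun x => u t x - E' t x) ∧
      Continuous fun x => fderiv ℝ (E' t) x := fun t ht =>
    ⟨(cu.comp_continuous (f := fun x : EuclideanSpace ℝ (Fin 3) => (t, x)) (by fun_prop)
        fun x => ⟨ht, mem_univ _⟩ :),
      (cw.comp_continuous (f := fun x : EuclideanSpace ℝ (Fin 3) => (t, x)) (by fun_prop)
        fun x => ⟨ht, mem_univ _⟩ :),
      (hEDc.comp_continuous (f := fun x : EuclideanSpace ℝ (Fin 3) => (t, x)) (by fun_prop)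
        fun x => ⟨ht.1, mem_univ _⟩ :)⟩
  have hw2 : ∀ t ∈ Ioo 0 S, MemLp (fun x => u t x - E' t x) 2 volume := fun t ht => by
    obtain ⟨Bw, hBw⟩ := hw (t / 2) (by linarith [ht.1])
    exact (hBw t ⟨by linarith [ht.1], ht.2⟩).1
  -- (A) `∫χₙ|w(t)|² → ∫|w(t)|²`
  have hlim : ∀ t ∈ Ioo 0 S, Tendsto (fun n : ℕ => ∫ x, cutoff ((n : ℝ) + 1) x * ‖u t x - E' t x‖ ^ 2)
      atTop (𝓝 (∫ x, ‖u t x - E' t x‖ ^ 2)) := fun t ht =>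
    tendsto_integral_cutoff_mul_norm_sq (hw2 t ht)
  -- (B) measurability of `t ↦ ∫|w(t)|²`
  have hymeas : AEStronglyMeasurable (fun t => ∫ x, ‖u t x - E' t x‖ ^ 2) (volume.restrict (Ioo 0 S)) := by
    refine aestronglyMeasurable_of_tendsto_ae (u := (atTop : Filter ℕ))
      (f := fun (n : ℕ) (t : ℝ) => ∫ x, cutoff ((n : ℝ) + 1) x * ‖u t x - E' t x‖ ^ 2) (fun n => ?_) ?_
    · exact (continuousOn_integral_mul_norm_sq_remainder hS hcont hK hdiv hmild hEc hEB (hψsm n)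
        (hψcs n)).aestronglyMeasurable measurableSet_Ioo
    · filter_upwards [ae_restrict_mem measurableSet_Ioo] with t ht
      exact hlim t ht
  refine ⟨hymeas, fun t₁ t₂ ht₁ h12 ht₂ => ?_⟩
  -- (C) the window `(t₁/2, S)`
  set δ : ℝ := t₁ / 2 with hδ_def
  have hδ : 0 < δ := by positivity
  have hδt₁ : δ < t₁ := by rw [hδ_def]; linarith
  have hsub : Ioc t₁ t₂ ⊆ Ioo δ S := fun t ht => ⟨hδt₁.trans ht.1, ht.2.trans_lt ht₂⟩
  have hsub0 : Ioc t₁ t₂ ⊆ Ioo 0 S := fun t ht => ⟨ht₁.trans ht.1, ht.2.trans_lt ht₂⟩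
  obtain ⟨Bw, hBw⟩ := hw δ hδ
  obtain ⟨B, hB0, hB⟩ := exists_window_bounds hS hcont hK hdiv hmild hEB hδ
  have hy0 : ∀ t, 0 ≤ ∫ x, ‖u t x - E' t x‖ ^ 2 := fun t => integral_nonneg fun x => by positivity
  have hBw0 : 0 ≤ Bw := (hy0 t₁).trans (hBw t₁ ⟨hδt₁, h12.trans_lt ht₂⟩).2
  have hyB : ∀ t ∈ Ioc t₁ t₂, ∫ x, ‖u t x - E' t x‖ ^ 2 ≤ Bw := fun t ht => (hBw t (hsub ht)).2
  -- bounds of `D`, `M` on `[t₁, t₂]`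
  have hIcc : Icc t₁ t₂ ⊆ Ioi 0 := fun t ht => ht₁.trans_le ht.1
  obtain ⟨D₁, hD₁⟩ := isCompact_Icc.exists_bound_of_continuousOn (hDc.mono hIcc)
  obtain ⟨M₁, hM₁⟩ := isCompact_Icc.exists_bound_of_continuousOn (hMc.mono hIcc)
  -- integrability of the Grönwall kernel on `(t₁, t₂]`
  have hbmeas : AEStronglyMeasurable (fun t => D t * (∫ x, ‖u t x - E' t x‖ ^ 2) +
      M t * Real.sqrt (∫ x, ‖u t x - E' t x‖ ^ 2)) (volume.restrict (Ioc t₁ t₂)) := by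
    have hy' : AEStronglyMeasurable (fun t => ∫ x, ‖u t x - E' t x‖ ^ 2) (volume.restrict (Ioc t₁ t₂)) :=
      hymeas.mono_measure (Measure.restrict_mono hsub0 le_rfl)
    have hD' : AEStronglyMeasurable D (volume.restrict (Ioc t₁ t₂)) :=
      ((hDc.mono (hsub0.trans fun t ht => ht.1)).aestronglyMeasurable measurableSet_Ioc)
    have hM' : AEStronglyMeasurable M (volume.restrict (Ioc t₁ t₂)) :=
      ((hMc.mono (hsub0.trans fun t ht => ht.1)).aestronglyMeasurable measurableSet_Ioc)
    exact (hD'.mul hy').add (hM'.mul (Real.continuous_sqrt.comp_aestronglyMeasurable hy'))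
  have hbB : ∀ t ∈ Ioc t₁ t₂, ‖D t * (∫ x, ‖u t x - E' t x‖ ^ 2) +
      M t * Real.sqrt (∫ x, ‖u t x - E' t x‖ ^ 2)‖ ≤ D₁ * Bw + M₁ * Real.sqrt Bw := by
    intro t ht
    have hD1 := hD₁ t (Ioc_subset_Icc_self ht)
    have hM1 := hM₁ t (Ioc_subset_Icc_self ht)
    rw [Real.norm_eq_abs] at hD1 hM1
    refine (norm_add_le _ _).trans (add_le_add ?_ ?_)
    · rw [norm_mul, Real.norm_eq_abs, Real.norm_of_nonneg (hy0 t)]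
      exact mul_le_mul hD1 (hyB t ht) (hy0 t) ((abs_nonneg _).trans hD1)
    · rw [norm_mul, Real.norm_eq_abs, Real.norm_of_nonneg (Real.sqrt_nonneg _)]
      exact mul_le_mul hM1 (Real.sqrt_le_sqrt (hyB t ht)) (Real.sqrt_nonneg _) ((abs_nonneg _).trans hM1)
  have hbint : IntegrableOn (fun t => D t * (∫ x, ‖u t x - E' t x‖ ^ 2) +
      M t * Real.sqrt (∫ x, ‖u t x - E' t x‖ ^ 2)) (Ioc t₁ t₂) volume := by
    haveI : IsFiniteMeasure ((volume : Measure ℝ).restrict (Ioc t₁ t₂)) :=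
      isFiniteMeasure_restrict.2 measure_Ioc_lt_top.ne
    refine ⟨hbmeas, HasFiniteIntegral.of_bounded (C := D₁ * Bw + M₁ * Real.sqrt Bw) ?_⟩
    filter_upwards [ae_restrict_mem measurableSet_Ioc] with t ht
    exact hbB t ht
  refine ⟨hbint, ?_⟩
  -- abbreviations
  set y : ℝ → ℝ := fun t => ∫ x, ‖u t x - E' t x‖ ^ 2 with hy_def
  set b : ℝ → ℝ := fun t => D t * (∫ x, ‖u t x - E' t x‖ ^ 2) + M t * Real.sqrt (∫ x, ‖u t x - E' t x‖ ^ 2)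
    with hb_def
  set Yn : ℕ → ℝ → ℝ := fun n t => ∫ x, cutoff ((n : ℝ) + 1) x * ‖u t x - E' t x‖ ^ 2 with hYn_def
  -- `|w|²` and `p` on the strip `(t₁, t₂] × ℝ³`
  obtain ⟨hwstrip, hwstrip_le⟩ := integrableOn_norm_sq_strip cw ht₁ h12 ht₂ fun t ht => hBw t (hsub ht)
  have hstrip_sub : Ioc t₁ t₂ ×ˢ (univ : Set (EuclideanSpace ℝ (Fin 3))) ⊆ Ioo 0 S ×ˢ univ :=
    prod_mono hsub0 Subset.rfl
  have hstrip_subδ : Ioc t₁ t₂ ×ˢ (univ : Set (EuclideanSpace ℝ (Fin 3))) ⊆ Ioo δ S ×ˢ univ :=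
    prod_mono hsub Subset.rfl
  have hstrip_m : MeasurableSet (Ioc t₁ t₂ ×ˢ (univ : Set (EuclideanSpace ℝ (Fin 3)))) :=
    measurableSet_Ioc.prod MeasurableSet.univ
  have hμ : (volume : Measure (ℝ × EuclideanSpace ℝ (Fin 3))).restrict
      (Ioc t₁ t₂ ×ˢ (univ : Set (EuclideanSpace ℝ (Fin 3)))) =
      ((volume : Measure ℝ).restrict (Ioc t₁ t₂)).prod (volume : Measure (EuclideanSpace ℝ (Fin 3))) := by
    rw [Measure.volume_eq_prod, Measure.restrict_prod_eq_prod_univ]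
  have hp2s : MemLp (uncurry p) 2 (volume.restrict (Ioc t₁ t₂ ×ˢ (univ : Set (EuclideanSpace ℝ (Fin 3))))) :=
    hp2.mono_measure (Measure.restrict_mono hstrip_sub le_rfl)
  have hp2int : Integrable (fun z : ℝ × EuclideanSpace ℝ (Fin 3) => |p z.1 z.2| ^ 2)
      (volume.restrict (Ioc t₁ t₂ ×ˢ (univ : Set (EuclideanSpace ℝ (Fin 3))))) := by
    have h := hp2s.integrable_sq
    refine h.congr (Eventually.of_forall fun z => ?_)
    simp [uncurry, sq_abs]
  set P : ℝ := Real.sqrt (∫ z in Ioc t₁ t₂ ×ˢ (univ : Set (EuclideanSpace ℝ (Fin 3))), |p z.1 z.2| ^ 2)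
    with hP_def
  -- the error sizes
  set e₁ : ℕ → ℝ := fun n => (t₂ - t₁) * ((CΔ + B * Cg) * Bw) * (1 / ((n : ℝ) + 1)) with he₁
  set e₂ : ℕ → ℝ := fun n => P * (Cg * Real.sqrt ((t₂ - t₁) * Bw)) * (1 / ((n : ℝ) + 1)) with he₂
  have he₁0 : Tendsto e₁ atTop (𝓝 0) := by
    have h := (tendsto_one_div_add_atTop_nhds_zero_nat).const_mul ((t₂ - t₁) * ((CΔ + B * Cg) * Bw))
    rw [mul_zero] at h
    exact h
  have he₂0 : Tendsto e₂ atTop (𝓝 0) := by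
    have h := (tendsto_one_div_add_atTop_nhds_zero_nat).const_mul (P * (Cg * Real.sqrt ((t₂ - t₁) * Bw)))
    rw [mul_zero] at h
    exact h
  -- ### the inequality for each cut-off
  have hstep : ∀ n : ℕ, Yn n t₂ ≤ Yn n t₁ + e₁ n + 2 * e₂ n + 2 * ∫ t in Ioc t₁ t₂, b t := by
    intro n
    set R : ℝ := (n : ℝ) + 1 with hR_def
    have hR0 : 0 < R := hR n
    have hR1 : 1 ≤ R := by rw [hR_def]; linarith [n.cast_nonneg (α := ℝ)]
    set ψ : EuclideanSpace ℝ (Fin 3) → ℝ := cutoff R with hψ_def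
    obtain ⟨iT1, iT2, iT3, hineq⟩ := remainder_tested_energy_inequality hS hcont hK hdiv hmild hEc hEDc hEΔc
      hEsm hEdiv hEt hEB hNS hp2 (hψsm n) (hψcs n) (cutoff_nonneg R) ht₁ h12 ht₂
    -- pointwise sizes of the cut-off
    have hg1 : ∀ x, ‖gradient ψ x‖ ≤ Cg / R := fun x => hCg R hR0 x
    have hΔ1 : ∀ x, |(Δ ψ) x| ≤ CΔ / R := fun x => (hCΔ R hR0 x).trans
      (div_le_div_of_nonneg_left hCΔ0 hR0 (by nlinarith [hR1]))
    have hgR : 0 ≤ Cg / R := by positivity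
    -- (1) the transport/Laplacian term
    have hT1 : ∀ t ∈ Ioc t₁ t₂, ‖∫ x, ((Δ ψ) x + ⟪u t x, gradient ψ x⟫) * ‖u t x - E' t x‖ ^ 2‖ ≤
        (CΔ + B * Cg) * Bw * (1 / R) := by
      intro t ht
      have hyI : Integrable (fun x => ‖u t x - E' t x‖ ^ 2) volume :=
        (memLp_two_iff_integrable_sq_norm (hw2 t (hsub0 ht)).1).1 (hw2 t (hsub0 ht))
      have hpt : ∀ x, ‖((Δ ψ) x + ⟪u t x, gradient ψ x⟫) * ‖u t x - E' t x‖ ^ 2‖ ≤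
          ((CΔ + B * Cg) * (1 / R)) * ‖u t x - E' t x‖ ^ 2 := by
        intro x
        obtain ⟨hu, -, -, -, -, -⟩ := hB t (hsub ht) x
        rw [norm_mul, norm_pow, norm_norm]
        refine mul_le_mul_of_nonneg_right ?_ (by positivity)
        refine (norm_add_le _ _).trans ?_
        rw [Real.norm_eq_abs]
        have h2 : ‖⟪u t x, gradient ψ x⟫‖ ≤ B * (Cg / R) :=
          (norm_inner_le_norm _ _).trans (mul_le_mul hu (hg1 x) (norm_nonneg _) hB0)
        calc |(Δ ψ) x| + ‖⟪u t x, gradient ψ x⟫‖ ≤ CΔ / R + B * (Cg / R) := add_le_add (hΔ1 x) h2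
          _ = (CΔ + B * Cg) * (1 / R) := by ring
      calc ‖∫ x, ((Δ ψ) x + ⟪u t x, gradient ψ x⟫) * ‖u t x - E' t x‖ ^ 2‖
          ≤ ∫ x, ((CΔ + B * Cg) * (1 / R)) * ‖u t x - E' t x‖ ^ 2 :=
            norm_integral_le_of_norm_le (hyI.const_mul _) (Eventually.of_forall hpt)
        _ = ((CΔ + B * Cg) * (1 / R)) * y t := integral_const_mul _ _
        _ ≤ ((CΔ + B * Cg) * (1 / R)) * Bw := by gcongr; exact hyB t ht
        _ = (CΔ + B * Cg) * Bw * (1 / R) := by ring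
    have hI1 : ‖∫ t in Ioc t₁ t₂, ∫ x, ((Δ ψ) x + ⟪u t x, gradient ψ x⟫) * ‖u t x - E' t x‖ ^ 2‖ ≤ e₁ n := by
      refine (norm_setIntegral_le_of_norm_le_const measure_Ioc_lt_top hT1).trans_eq ?_
      rw [Measure.real, Real.volume_Ioc, ENNReal.toReal_ofReal (by linarith), he₁]
      ring
    -- (2) the pressure term, through the strip
    obtain ⟨-, -, hFPi, -, -, -, -⟩ := integrableOn_strip_tested_terms hS hcont hK hdiv hmild hEc hEDc hEB hp2
      (hψsm n) (hψcs n) hδ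
    have hFPs : IntegrableOn (fun z : ℝ × EuclideanSpace ℝ (Fin 3) =>
        p z.1 z.2 * ⟪u z.1 z.2 - E' z.1 z.2, gradient ψ z.2⟫)
        (Ioc t₁ t₂ ×ˢ (univ : Set (EuclideanSpace ℝ (Fin 3)))) volume := hFPi.mono_set hstrip_subδ
    have hFub : ∫ t in Ioc t₁ t₂, ∫ x, p t x * ⟪u t x - E' t x, gradient ψ x⟫ =
        ∫ z in Ioc t₁ t₂ ×ˢ (univ : Set (EuclideanSpace ℝ (Fin 3))), p z.1 z.2 * ⟪u z.1 z.2 - E' z.1 z.2, gradient ψ z.2⟫ := by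
      have h' : Integrable (fun z : ℝ × EuclideanSpace ℝ (Fin 3) => p z.1 z.2 * ⟪u z.1 z.2 - E' z.1 z.2, gradient ψ z.2⟫)
          (((volume : Measure ℝ).restrict (Ioc t₁ t₂)).prod (volume : Measure (EuclideanSpace ℝ (Fin 3)))) := by
        have h := hFPs; rw [IntegrableOn, hμ] at h; exact h
      rw [show (∫ z in Ioc t₁ t₂ ×ˢ (univ : Set (EuclideanSpace ℝ (Fin 3))),
          p z.1 z.2 * ⟪u z.1 z.2 - E' z.1 z.2, gradient ψ z.2⟫) =
        ∫ z, p z.1 z.2 * ⟪u z.1 z.2 - E' z.1 z.2, gradient ψ z.2⟫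
          ∂(((volume : Measure ℝ).restrict (Ioc t₁ t₂)).prod (volume : Measure (EuclideanSpace ℝ (Fin 3)))) by
        rw [← hμ], integral_prod _ h']
    have hgs : Integrable (fun z : ℝ × EuclideanSpace ℝ (Fin 3) => |⟪u z.1 z.2 - E' z.1 z.2, gradient ψ z.2⟫| ^ 2)
        (volume.restrict (Ioc t₁ t₂ ×ˢ (univ : Set (EuclideanSpace ℝ (Fin 3))))) := by
      have hgm : AEStronglyMeasurable (fun z : ℝ × EuclideanSpace ℝ (Fin 3) => ⟪u z.1 z.2 - E' z.1 z.2, gradient ψ z.2⟫)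
          (volume.restrict (Ioc t₁ t₂ ×ˢ (univ : Set (EuclideanSpace ℝ (Fin 3))))) := by
        have cg : Continuous (gradient ψ) := by
          change Continuous fun x => (InnerProductSpace.toDual ℝ (EuclideanSpace ℝ (Fin 3))).symm (fderiv ℝ ψ x)
          exact (InnerProductSpace.toDual ℝ (EuclideanSpace ℝ (Fin 3))).symm.continuous.comp
            ((hψsm n).continuous_fderiv (by simp))
        exact ((cw.mono hstrip_sub).inner (cg.comp continuous_snd).continuousOn).aestronglyMeasurable hstrip_m
      refine (hwstrip.const_mul ((Cg / R) ^ 2)).mono' ((hgm.norm).pow 2) (Eventually.of_forall fun z => ?_)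
      rw [Real.norm_eq_abs, abs_pow, abs_abs, ← Real.norm_eq_abs]
      calc ‖⟪u z.1 z.2 - E' z.1 z.2, gradient ψ z.2⟫‖ ^ 2 ≤ (‖u z.1 z.2 - E' z.1 z.2‖ * (Cg / R)) ^ 2 := by
            gcongr
            exact (norm_inner_le_norm _ _).trans (mul_le_mul_of_nonneg_left (hg1 _) (norm_nonneg _))
        _ = (Cg / R) ^ 2 * ‖u z.1 z.2 - E' z.1 z.2‖ ^ 2 := by ring
    have hpm : AEStronglyMeasurable (fun z : ℝ × EuclideanSpace ℝ (Fin 3) => |p z.1 z.2|)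
        (volume.restrict (Ioc t₁ t₂ ×ˢ (univ : Set (EuclideanSpace ℝ (Fin 3))))) := by
      have h := hp2s.1.norm; simpa [uncurry, Real.norm_eq_abs] using h
    have hgm' : AEStronglyMeasurable (fun z : ℝ × EuclideanSpace ℝ (Fin 3) => |⟪u z.1 z.2 - E' z.1 z.2, gradient ψ z.2⟫|)
        (volume.restrict (Ioc t₁ t₂ ×ˢ (univ : Set (EuclideanSpace ℝ (Fin 3))))) := by
      have h := (hFPs.1 : AEStronglyMeasurable _ _)
      have cg : Continuous (gradient ψ) := by
        change Continuous fun x => (InnerProductSpace.toDual ℝ (EuclideanSpace ℝ (Fin 3))).symm (fderiv ℝ ψ x)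
        exact (InnerProductSpace.toDual ℝ (EuclideanSpace ℝ (Fin 3))).symm.continuous.comp
          ((hψsm n).continuous_fderiv (by simp))
      have h2 : AEStronglyMeasurable (fun z : ℝ × EuclideanSpace ℝ (Fin 3) => ⟪u z.1 z.2 - E' z.1 z.2, gradient ψ z.2⟫)
          (volume.restrict (Ioc t₁ t₂ ×ˢ (univ : Set (EuclideanSpace ℝ (Fin 3))))) :=
        ((cw.mono hstrip_sub).inner (cg.comp continuous_snd).continuousOn).aestronglyMeasurable hstrip_m
      have h3 := h2.norm; simpa [Real.norm_eq_abs] using h3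
    have hCS := integral_mul_le_sqrt_mul_sqrt
      (μ := volume.restrict (Ioc t₁ t₂ ×ˢ (univ : Set (EuclideanSpace ℝ (Fin 3)))))
      (fun z => abs_nonneg _) (fun z => abs_nonneg _) hpm hgm' hp2int hgs
    have hg2le : ∫ z in Ioc t₁ t₂ ×ˢ (univ : Set (EuclideanSpace ℝ (Fin 3))),
        |⟪u z.1 z.2 - E' z.1 z.2, gradient ψ z.2⟫| ^ 2 ≤ (Cg / R) ^ 2 * ((t₂ - t₁) * Bw) := by
      calc ∫ z in Ioc t₁ t₂ ×ˢ (univ : Set (EuclideanSpace ℝ (Fin 3))), |⟪u z.1 z.2 - E' z.1 z.2, gradient ψ z.2⟫| ^ 2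
          ≤ ∫ z in Ioc t₁ t₂ ×ˢ (univ : Set (EuclideanSpace ℝ (Fin 3))), (Cg / R) ^ 2 * ‖u z.1 z.2 - E' z.1 z.2‖ ^ 2 := by
            refine integral_mono hgs (hwstrip.const_mul _) fun z => ?_
            calc |⟪u z.1 z.2 - E' z.1 z.2, gradient ψ z.2⟫| ^ 2 ≤ (‖u z.1 z.2 - E' z.1 z.2‖ * (Cg / R)) ^ 2 :=
                  pow_le_pow_left₀ (abs_nonneg _) ((abs_real_inner_le_norm _ _).trans
                    (mul_le_mul_of_nonneg_left (hg1 _) (norm_nonneg _))) 2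
              _ = (Cg / R) ^ 2 * ‖u z.1 z.2 - E' z.1 z.2‖ ^ 2 := by ring
        _ = (Cg / R) ^ 2 * ∫ z in Ioc t₁ t₂ ×ˢ (univ : Set (EuclideanSpace ℝ (Fin 3))), ‖u z.1 z.2 - E' z.1 z.2‖ ^ 2 :=
            integral_const_mul _ _
        _ ≤ (Cg / R) ^ 2 * ((t₂ - t₁) * Bw) := by gcongr
    have hI2 : ‖∫ t in Ioc t₁ t₂, ∫ x, p t x * ⟪u t x - E' t x, gradient ψ x⟫‖ ≤ e₂ n := by
      rw [hFub, Real.norm_eq_abs]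
      calc |∫ z in Ioc t₁ t₂ ×ˢ (univ : Set (EuclideanSpace ℝ (Fin 3))), p z.1 z.2 * ⟪u z.1 z.2 - E' z.1 z.2, gradient ψ z.2⟫|
          ≤ ∫ z in Ioc t₁ t₂ ×ˢ (univ : Set (EuclideanSpace ℝ (Fin 3))), |p z.1 z.2 * ⟪u z.1 z.2 - E' z.1 z.2, gradient ψ z.2⟫| :=
            abs_integral_le_integral_abs
        _ = ∫ z in Ioc t₁ t₂ ×ˢ (univ : Set (EuclideanSpace ℝ (Fin 3))), |p z.1 z.2| * |⟪u z.1 z.2 - E' z.1 z.2, gradient ψ z.2⟫| :=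
            integral_congr_ae (Eventually.of_forall fun z => abs_mul _ _)
        _ ≤ P * Real.sqrt (∫ z in Ioc t₁ t₂ ×ˢ (univ : Set (EuclideanSpace ℝ (Fin 3))),
              |⟪u z.1 z.2 - E' z.1 z.2, gradient ψ z.2⟫| ^ 2) := hCS
        _ ≤ P * Real.sqrt ((Cg / R) ^ 2 * ((t₂ - t₁) * Bw)) := by gcongr
        _ = e₂ n := by
            rw [Real.sqrt_mul (sq_nonneg _), Real.sqrt_sq hgR, he₂]
            simp only [hR_def]
            ring
    -- (3) the coupling term
    have hT3 : ∀ t ∈ Ioc t₁ t₂, -b t ≤ ∫ x, ψ x * ⟪fderiv ℝ (E' t) x (u t x), u t x - E' t x⟫ := by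
      intro t ht
      have ht0 := hsub0 ht
      obtain ⟨huc, hwc, hDEc⟩ := hslice t ht0
      obtain ⟨hMEt, hMt⟩ := hME t ht0
      obtain ⟨hint, hle⟩ := integral_abs_coupling_le huc hwc hDEc (hw2 t ht0) (hD t ht0) hMEt hMt (hM0 t)
      have h1 : ‖∫ x, ψ x * ⟪fderiv ℝ (E' t) x (u t x), u t x - E' t x⟫‖ ≤
          ∫ x, |⟪fderiv ℝ (E' t) x (u t x), u t x - E' t x⟫| := by
        refine norm_integral_le_of_norm_le hint.abs (Eventually.of_forall fun x => ?_)
        rw [norm_mul, Real.norm_of_nonneg (cutoff_nonneg _ _), Real.norm_eq_abs]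
        exact mul_le_of_le_one_left (abs_nonneg _) (cutoff_le_one _ _)
      rw [Real.norm_eq_abs] at h1
      have h2 := neg_abs_le (∫ x, ψ x * ⟪fderiv ℝ (E' t) x (u t x), u t x - E' t x⟫)
      simp only [hb_def]
      linarith
    have hI3 : -(∫ t in Ioc t₁ t₂, b t) ≤ ∫ t in Ioc t₁ t₂, ∫ x, ψ x * ⟪fderiv ℝ (E' t) x (u t x), u t x - E' t x⟫ := by
      rw [← integral_neg]
      exact setIntegral_mono_on hbint.neg iT3 measurableSet_Ioc hT3
    -- (4) assemble
    have i12 : IntegrableOn (fun t => (∫ x, ((Δ ψ) x + ⟪u t x, gradient ψ x⟫) * ‖u t x - E' t x‖ ^ 2) +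
        2 * ∫ x, p t x * ⟪u t x - E' t x, gradient ψ x⟫) (Ioc t₁ t₂) volume := iT1.add (iT2.const_mul 2)
    have i3 : IntegrableOn (fun t => 2 * ∫ x, ψ x * ⟪fderiv ℝ (E' t) x (u t x), u t x - E' t x⟫)
        (Ioc t₁ t₂) volume := iT3.const_mul 2
    have hsplit : ∫ t in Ioc t₁ t₂, ((∫ x, ((Δ ψ) x + ⟪u t x, gradient ψ x⟫) * ‖u t x - E' t x‖ ^ 2) +
        2 * (∫ x, p t x * ⟪u t x - E' t x, gradient ψ x⟫) -
        2 * ∫ x, ψ x * ⟪fderiv ℝ (E' t) x (u t x), u t x - E' t x⟫) =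
        (∫ t in Ioc t₁ t₂, ∫ x, ((Δ ψ) x + ⟪u t x, gradient ψ x⟫) * ‖u t x - E' t x‖ ^ 2) +
          2 * (∫ t in Ioc t₁ t₂, ∫ x, p t x * ⟪u t x - E' t x, gradient ψ x⟫) -
          2 * ∫ t in Ioc t₁ t₂, ∫ x, ψ x * ⟪fderiv ℝ (E' t) x (u t x), u t x - E' t x⟫ := by
      rw [integral_sub i12 i3, integral_add iT1 (iT2.const_mul 2), integral_const_mul, integral_const_mul]
    have hx1 := le_trans (le_abs_self _) (show |∫ t in Ioc t₁ t₂, ∫ x, ((Δ ψ) x + ⟪u t x, gradient ψ x⟫) *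
      ‖u t x - E' t x‖ ^ 2| ≤ e₁ n from (Real.norm_eq_abs _).symm.le.trans hI1)
    have hx2 := le_trans (le_abs_self _) (show |∫ t in Ioc t₁ t₂, ∫ x, p t x * ⟪u t x - E' t x, gradient ψ x⟫| ≤ e₂ n
      from (Real.norm_eq_abs _).symm.le.trans hI2)
    have hineq' := hineq
    rw [hsplit] at hineq'
    simp only [hYn_def]
    linarith
  -- ### the limit `n → ∞`
  have ht₁' : t₁ ∈ Ioo 0 S := ⟨ht₁, h12.trans_lt ht₂⟩
  have ht₂' : t₂ ∈ Ioo 0 S := ⟨ht₁.trans_le h12, ht₂⟩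
  have hL : Tendsto (fun n => Yn n t₂) atTop (𝓝 (y t₂)) := hlim t₂ ht₂'
  have hRlim : Tendsto (fun n => Yn n t₁ + e₁ n + 2 * e₂ n + 2 * ∫ t in Ioc t₁ t₂, b t) atTop
      (𝓝 (y t₁ + 0 + 2 * 0 + 2 * ∫ t in Ioc t₁ t₂, b t)) :=
    (((hlim t₁ ht₁').add he₁0).add (he₂0.const_mul 2)).add tendsto_const_nhds
  have h := le_of_tendsto_of_tendsto' hL hRlim hstep
  simp only [add_zero, mul_zero] at h
  exact h

end Literature.Analysis.FluidPDE

end
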